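import Mathlib.Algebra.MvPolynomial.CommRing
import Mathlib.Algebra.MvPolynomial.PDeriv
import Mathlib.Data.Finsupp.Antidiagonal
import Mathlib.Data.Finset.NatAntidiagonal
import HarnessLib

/-!
# First-order coefficients of multi-parameter substitutions (instrument for the `W(f)` toy model — NOT a resolution
theorem)

Generic commutative algebra (ours, bookkeeping over [Lang2002, Ch. IV §1]): for a `K`-algebra map
`Ψ : MvPolynomial ι K →ₐ[K] MvPolynomial τ (MvPolynomial ι K)` whose generator images have constant terms
`coeff 0 (Ψ (X j)) = X j` ("a deformation of the identity with parameters `λ_t = X t`"),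

* `coeff_zero_eq_self` : `coeff 0 (Ψ G) = G`;
* `coeff_single_one_eq_sum` : the coefficient of a single parameter `λ_t` is the directional derivative with
  POLYNOMIAL coefficients, `coeff (e_t) (Ψ G) = Σ_j coeff (e_t) (Ψ (X j)) * ∂_j G` (first-order Taylor formula);
* `coeff_single_one_aeval_add_sum` : for the universal multi-parameter shift
  `X j ↦ C (X j) + Σ_t X t * C (v t j)` (this `aeval` is, by `rfl`, the cell's `MonomialCurve.multiShift v` of
  `WeightedCentreMonomialCurve.lean`, not imported so that this file builds on Mathlib alone) the `λ_t`-coefficient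
  of the image of `G` is `Σ_j v t j * ∂_j G` ("`Ψ_{0,1} = D g`, `D = Σ_x P_{p,x} ∂_x`" in the engine's THEOREM RZ,
  cell notes RE-DERIVATION-eng1-g41 §3.7.4), and its constant term is `G`.

Also the coefficient identity `coeff_single_one_mul` (`[λ_t] (F H) = [1]F [λ_t]H + [λ_t]F [1]H`).

VALUE: bookkeeping for a toy model (Resolution Observatory cell `pub-rosobs`, carver lane gen 62; AI-written Lean, and
AI review is weaker than expert review); nothing here is specific to resolution of singularities, NOT a statement
about the invariant of [AbramovichTemkinWlodarczyk2024], NOT progress on the summit.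
-/

namespace Literature.AlgebraicGeometry.Resolution.WeightedBlowup

namespace FirstOrder

open MvPolynomial

section General

variable {A : Type*} [CommRing A] {τ : Type*}

/-- (ours, bookkeeping) The coefficient of a single parameter in a product:
`[λ_t] (F H) = [1]F · [λ_t]H + [λ_t]F · [1]H`. [cite: Lang2002, Ch. IV §1] -/
theorem coeff_single_one_mul (t : τ) (F H : MvPolynomial τ A) :
    coeff (Finsupp.single t 1) (F * H)
      = coeff 0 F * coeff (Finsupp.single t 1) H + coeff (Finsupp.single t 1) F * coeff 0 H := by
  classical
  rw [coeff_mul, Finsupp.antidiagonal_single, Finset.sum_map, Finset.Nat.antidiagonal_succ, Finset.sum_cons,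
    Finset.sum_map, Finset.Nat.antidiagonal_zero, Finset.sum_singleton]
  simp

end General

section Deformation

variable {K : Type*} [CommRing K] {ι τ : Type*}

/-- (ours, bookkeeping) A `K`-algebra map into the parameter ring whose generator images have constant terms `X j`
has constant term the identity: `coeff 0 (Ψ G) = G`. [cite: Lang2002, Ch. IV §1] -/
theorem coeff_zero_eq_self (Ψ : MvPolynomial ι K →ₐ[K] MvPolynomial τ (MvPolynomial ι K))
    (h0 : ∀ j, coeff 0 (Ψ (X j)) = X j) (G : MvPolynomial ι K) : coeff 0 (Ψ G) = G := by
  have key : (constantCoeff.comp (Ψ : MvPolynomial ι K →+* MvPolynomial τ (MvPolynomial ι K)))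
      = RingHom.id (MvPolynomial ι K) := by
    refine MvPolynomial.ringHom_ext (fun c => ?_) (fun j => ?_)
    · rw [RingHom.comp_apply, RingHom.id_apply, RingHom.coe_coe, ← MvPolynomial.algebraMap_eq, AlgHom.commutes,
        IsScalarTower.algebraMap_apply K (MvPolynomial ι K) (MvPolynomial τ (MvPolynomial ι K)),
        MvPolynomial.algebraMap_eq, MvPolynomial.algebraMap_eq, constantCoeff_C]
    · rw [RingHom.comp_apply, RingHom.id_apply, RingHom.coe_coe, constantCoeff_eq, h0]
  have := DFunLike.congr_fun key G
  rwa [RingHom.comp_apply, RingHom.id_apply, RingHom.coe_coe, constantCoeff_eq] at this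

/-- (ours, bookkeeping) FIRST-ORDER TAYLOR FORMULA with polynomial coefficients: for such a `Ψ`, the coefficient of
the single parameter `λ_t` in `Ψ G` is `Σ_j coeff (e_t) (Ψ (X j)) * ∂_j G`. [cite: Lang2002, Ch. IV §1] -/
theorem coeff_single_one_eq_sum [Fintype ι] [DecidableEq ι]
    (Ψ : MvPolynomial ι K →ₐ[K] MvPolynomial τ (MvPolynomial ι K)) (h0 : ∀ j, coeff 0 (Ψ (X j)) = X j) (t : τ)
    (G : MvPolynomial ι K) :
    coeff (Finsupp.single t 1) (Ψ G) = ∑ j, coeff (Finsupp.single t 1) (Ψ (X j)) * pderiv j G := by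
  classical
  induction G using MvPolynomial.induction_on with
  | C a =>
    rw [← MvPolynomial.algebraMap_eq, AlgHom.commutes,
      IsScalarTower.algebraMap_apply K (MvPolynomial ι K) (MvPolynomial τ (MvPolynomial ι K)),
      MvPolynomial.algebraMap_eq, MvPolynomial.algebraMap_eq, coeff_C, if_neg (Finsupp.single_ne_zero.2 one_ne_zero).symm]
    simp
  | add p q hp hq =>
    rw [map_add, coeff_add, hp, hq, ← Finset.sum_add_distrib]
    refine Finset.sum_congr rfl fun j _ => ?_
    rw [map_add, mul_add]
  | mul_X p j hp =>
    rw [map_mul, coeff_single_one_mul, hp, coeff_zero_eq_self Ψ h0, h0]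
    simp_rw [pderiv_mul, pderiv_X, mul_add, Finset.sum_add_distrib, ← mul_assoc, ← Finset.sum_mul]
    rw [add_comm]
    congr 1
    rw [Finset.sum_eq_single j (fun i _ hij => by rw [Pi.single_eq_of_ne' hij, mul_zero])
      (fun h => absurd (Finset.mem_univ j) h), Pi.single_eq_same, mul_one, mul_comm]

/-- (ours, bookkeeping) The universal multi-parameter shift `X j ↦ C (X j) + Σ_t X t * C (v t j)` has constant
term `G` … [cite: Lang2002, Ch. IV §1] -/
theorem coeff_zero_aeval_add_sum [Fintype τ] (v : τ → ι → MvPolynomial ι K) (G : MvPolynomial ι K) :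
    coeff 0 (aeval (fun j => C (X j) + ∑ t, X t * C (v t j) :
      ι → MvPolynomial τ (MvPolynomial ι K)) G) = G := by
  classical
  refine coeff_zero_eq_self _ (fun j => ?_) G
  rw [aeval_X, coeff_add, coeff_C, if_pos rfl, coeff_sum, Finset.sum_eq_zero fun t _ => ?_, add_zero]
  rw [X, C_apply, monomial_mul, add_zero, coeff_monomial, if_neg (Finsupp.single_ne_zero.2 one_ne_zero)]

/-- (ours, bookkeeping) … and `λ_t`-coefficient the directional derivative `Σ_j v t j * ∂_j G` with POLYNOMIAL
coefficients ("`Ψ_{0,1} = D g`"). [cite: Lang2002, Ch. IV §1] -/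
theorem coeff_single_one_aeval_add_sum [Fintype ι] [DecidableEq ι] [Fintype τ] [DecidableEq τ]
    (v : τ → ι → MvPolynomial ι K) (t : τ) (G : MvPolynomial ι K) :
    coeff (Finsupp.single t 1) (aeval (fun j => C (X j) + ∑ t, X t * C (v t j) :
      ι → MvPolynomial τ (MvPolynomial ι K)) G) = ∑ j, v t j * pderiv j G := by
  classical
  have h0 : ∀ j, coeff 0 (aeval (fun j => C (X j) + ∑ t, X t * C (v t j) :
      ι → MvPolynomial τ (MvPolynomial ι K)) (X j : MvPolynomial ι K)) = X j := fun j =>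
    coeff_zero_aeval_add_sum v (X j)
  rw [coeff_single_one_eq_sum _ h0 t G]
  refine Finset.sum_congr rfl fun j _ => ?_
  congr 1
  rw [aeval_X, coeff_add, coeff_C, if_neg (Finsupp.single_ne_zero.2 one_ne_zero).symm, zero_add, coeff_sum,
    Finset.sum_eq_single t]
  · rw [X, C_apply, monomial_mul, coeff_monomial, if_pos (by simp), one_mul]
  · intro t' _ ht'
    rw [X, C_apply, monomial_mul, coeff_monomial, if_neg]
    rwa [add_zero, Finsupp.single_left_inj one_ne_zero]
  · exact fun h => absurd (Finset.mem_univ t) h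

end Deformation

/-! ## Smoke test -/

section SmokeTest

/- One slot, one parameter, `v = X²`: `[λ] (X + λ X²)^3 = 3 X² · X² = X² · ∂(X³)`. -/
example : coeff (Finsupp.single () 1)
    (aeval (fun j => C (X j) + ∑ t : Unit, X t * C ((fun _ _ => X () ^ 2 : Unit → Unit → MvPolynomial Unit ℤ) t j) :
      Unit → MvPolynomial Unit (MvPolynomial Unit ℤ)) (X () ^ 3 : MvPolynomial Unit ℤ))
      = ∑ j : Unit, (X () ^ 2 : MvPolynomial Unit ℤ) * pderiv j (X () ^ 3) :=
  coeff_single_one_aeval_add_sum _ () _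

end SmokeTest

end FirstOrder

end Literature.AlgebraicGeometry.Resolution.WeightedBlowup
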